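import Summits.CriticalPhenomena.Ising3DConformalLimit.Theorems.ExistsScaleCovariantLimit.Negative.TightnessUniqueness
import Summits.CriticalPhenomena.Ising3DConformalLimit.Theorems.HyperoctahedralRPExistsScaleCovariantLimitCompactnessItemMapsDoubling
import Summits.CriticalPhenomena.Ising3DConformalLimit.Theorems.HyperoctahedralRPExistsScaleCovariantLimitFoldedCurrentDefs
import Summits.CriticalPhenomena.Ising3DConformalLimit.Theorems.HyperoctahedralRPExistsScaleCovariantLimitFoldedCurrentWallRepulsionIffDoubling
import Summits.CriticalPhenomena.Ising3DConformalLimit.Theorems.HyperoctahedralRPExistsScaleCovariantLimitFoldedCurrentEngineIffDoubling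
import Summits.CriticalPhenomena.Ising3DConformalLimit.Theorems.HyperoctahedralRPExistsScaleCovariantLimitFoldedCurrentUniqueness
import Summits.CriticalPhenomena.Ising3DConformalLimit.Theorems.HyperoctahedralRPExistsScaleCovariantLimitSplitGlue
import Summits.CriticalPhenomena.Ising3DConformalLimit.Theses.PositivityBegetsConformality
import Summits.CriticalPhenomena.Ising3DConformalLimit.Theses.TauBallRounding
import HarnessLib

/-!
# The registered skeleton's COMPOSITION, landable sorry-free — crux `ExistsScaleCovariantLimit` (item stmt-CriticalPhenomena-1981)

Prepared by crux-strategist r1 [instTBR] (planner-cstrat-stmt-CriticalPhenomena-1981-r1-0, 2026-08-17) for the line lead of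
`folded-current-repulsion`: this is §4 of the registered skeleton `Cruxes/ExistsScaleCovariantLimit/Lines/folded_current_repulsion.lean`
(v9, lead c18) VERBATIM — the composition `ExistsScaleCovariantLimit_of : WallRepulsion → ClusterSetTotallyDisconnected → crux` — which uses
ONLY landed theorems and therefore lands on its own, without the two sorried stubs. Landing it (after `ledger workitem stub-add
stmt-CriticalPhenomena-1981 --name ExistsScaleCovariantLimit_of …` if the gate insists on a registered name) gives the tree a LANDED twin of the
skeleton's `X_of` assembly — the object the gate's RESTATED/BC2-redirect checker reports as `assembly.proved` (route payload `restated.assembly`),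
currently `false` on all 15 routes sharing the crux although the split glue `SplitGlue.hrp_crux_of_doubling_of_totallyDisconnected` (p154899) is landed.

* `ExistsScaleCovariantLimit_of` — skeleton v9 §4 verbatim (HyperoctahedralRP copy).
* `ExistsScaleCovariantLimit_of_tbr` / `_of_pbc` — the same at the TauBallRounding / PositivityBegetsConformality copies (same body; δ).
* `stubs_iff_children`, `ExistsScaleCovariantLimit_of_stubs_iff` — the two registered stubs are EXACTLY the two split children:
  `WallRepulsion ↔ TwoPointDoubling` (p138231), so `(WallRepulsion ∧ ClusterSetTotallyDisconnected) ↔ (TwoPointDoubling ∧ ClusterSetTotallyDisconnected) ↔ crux` (p139907).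

No `sorry`; axioms propext / Classical.choice / Quot.sound. Target suggestion:
`Theorems/HyperoctahedralRPExistsScaleCovariantLimitFoldedCurrentComposition.lean --supports stmt-CriticalPhenomena-1981`.
References: M. Aizenman, H. Duminil-Copin, Ann. of Math. 194 (2021), arXiv:1912.07973, Remark 5.10; H. Duminil-Copin, ICM 2022 §8.4.
-/

noncomputable section

open Literature.Probability.LatticeModels
open Summit.CriticalPhenomena.Ising3DConformalLimit.Theses

namespace Summit.CriticalPhenomena.Ising3DConformalLimit.Cruxes.ExistsScaleCovariantLimit.FoldedCurrentRepulsion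

/-- **COMPOSITION of the registered skeleton (v6–v9 §4, verbatim).** `WallRepulsion → ClusterSetTotallyDisconnected → ExistsScaleCovariantLimit`:
F2 is item 6150 (`wallRepulsion_iff_twoPointDoubling`, p138231), 6150 is `MonotoneRG.OrbitPrecompact` (`orbitPrecompact_iff_doubling`, p120504),
compactness + total disconnectedness of the cluster set give uniqueness of the cluster point
(`clusterPointUnique_of_orbitPrecompact_of_totallyDisconnected`), and compactness + uniqueness is the crux
(`ExistsScaleCovariantLimitNegative.crux_iff_orbitPrecompact_and_unique`, p78620). [cite: AizenmanDuminilCopinAnnals2021, arXiv:1912.07973 Remark 5.10] -/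
theorem ExistsScaleCovariantLimit_of :
    WallRepulsion → ClusterRigidity.ClusterSetTotallyDisconnected →
      Summit.CriticalPhenomena.Ising3DConformalLimit.Theses.HyperoctahedralRP.ExistsScaleCovariantLimit := by
  intro h2 h4
  have hP : MonotoneRG.OrbitPrecompact :=
    TwoHierarchies.ItemMaps.orbitPrecompact_iff_doubling.2 (wallRepulsion_iff_twoPointDoubling.1 h2)
  exact ExistsScaleCovariantLimitNegative.crux_iff_orbitPrecompact_and_unique.2
    ⟨hP, clusterPointUnique_of_orbitPrecompact_of_totallyDisconnected hP h4⟩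

/-- The same composition at route `TauBallRounding`'s copy of the shared decl (same body). [folklore] -/
theorem ExistsScaleCovariantLimit_of_tbr :
    WallRepulsion → ClusterRigidity.ClusterSetTotallyDisconnected → TauBallRounding.ExistsScaleCovariantLimit :=
  ExistsScaleCovariantLimit_of

/-- The same composition at route `PositivityBegetsConformality`'s copy of the shared decl (same body). [folklore] -/
theorem ExistsScaleCovariantLimit_of_pbc :
    WallRepulsion → ClusterRigidity.ClusterSetTotallyDisconnected → PositivityBegetsConformality.ExistsScaleCovariantLimit :=
  ExistsScaleCovariantLimit_of

/-- The registered stub pair and the split-child pair are the same decomposition: `(WallRepulsion ∧ TD) ↔ (TwoPointDoubling ∧ TD)`. [folklore] -/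
theorem stubs_iff_children :
    (WallRepulsion ∧ ClusterRigidity.ClusterSetTotallyDisconnected) ↔
      (MirrorHoelderCompactness.TwoPointDoubling ∧ ClusterRigidity.ClusterSetTotallyDisconnected) :=
  and_congr_left fun _ => wallRepulsion_iff_twoPointDoubling

/-- Exactness at the stub level: the crux ⟺ the conjunction of the two registered stubs. [cite: DuminilCopinICM2022, §8.4 p. 29] -/
theorem ExistsScaleCovariantLimit_of_stubs_iff :
    Summit.CriticalPhenomena.Ising3DConformalLimit.Theses.HyperoctahedralRP.ExistsScaleCovariantLimit ↔
      (WallRepulsion ∧ ClusterRigidity.ClusterSetTotallyDisconnected) :=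
  crux_iff_doubling_and_totallyDisconnected.trans stubs_iff_children.symm

end Summit.CriticalPhenomena.Ising3DConformalLimit.Cruxes.ExistsScaleCovariantLimit.FoldedCurrentRepulsion

end
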